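import Summits.CriticalPhenomena.PercolationContinuityZ3.Theorems.PercNearOneGluingNoHeavyConstsMDLXJointXEdgeInduction
import HarnessLib

/-!
# CROSS at the reach marker `u = z`, the marker-SATURATED quadrant `U ⊇ {s↔y}`: both members reduce to their value at `U = {s↔y}`
# by positive association of `C_s` given `s ↮ X ∪ {y}` (PAPER-2 track (ii), seat `prim-consts-2`, gen 21)

builds on p205010 (kernel theorem, internal audit signed; external expert review pending).  Support file (`--supports
stmt-CriticalPhenomena-4575`); theorems only, no sorries, standard axioms.  Memo `run/shared/lean/prim/consts/FROM-prim-consts-2-g21-GIBBS-ORBIT.md` §3.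

Notation (`Consts.MDLXJoint`, `Consts.polMargin`, `Consts.CrossRel`): owner `s`, avoided set `X`, markers `y`, `z`; `D = {s ↮ X}`, `D' = D ∖ Z`,
`Y = {s↔y}`, `Z = {s↔z}`, `N = D ∖ Y`, `T = {y ↮ {s}∪X} ∩ D`, `T' = {y ↮ {s,z}∪X} ∩ D'`, `t = μ(T)`, `tw = μ(T ∩ {y↔z})`, `t' = μ(T')`;
the two CROSS members of `Consts.CrossRel` at the added vertex `u = z` (`X' = X ∪ {z}`) are `M₁ = P(X',X,X)+P(X,X',X)+P(X,X,X')` and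
`M₂ = P(X',X',X)+P(X',X,X')+P(X,X',X')`.  THIS FILE: the quadrant `U ⊇ Y` — `F` reads `1{V(C_s) ∈ 𝒰}` with `𝒰` monotone and `y ∈ S → 𝒰 S`
(every increasing event of the vertex cluster CONTAINING `{s↔y}`).  With `V = Uᶜ` (a decreasing event inside `N`), `zv = μ(D∩Z∩V)`, `z̄v = μ(D'∩V)`
(and `zn, z̄n` the same at `V = N`, i.e. `U = Y`):
  `M₂(U) = z̄v·(t'·μ(D∩Z) − tw·μ(D'∩Y)) − t'·μ(D')·zv`,     `M₁(U) = z̄v·[(t+t')μ(D∩Z) − tw(μ(D∩Y)+μ(D'∩Y))] − zv·[(t+t')μ(D') + tw·μ(D'∩Y)]`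
(exact; the coefficients do not depend on `U`), and van den Berg–Häggström–Kahn's Theorem 1.3 with sets (`{s}` repelled from `X ∪ {y}`: `{s↔z}` and
`U` are positively correlated given `s ↮ X∪{y}`) gives `zv·z̄n ≤ zn·z̄v`.  Hence BOTH members on the whole quadrant follow from their values at the
corner `U = Y` (`F = 1{s↔y}` = `connIndicatorFn s y`), which are instances (`𝒰 S := y ∈ S`) of the marker-PINNED theorems
`Consts.crossRel_reach_M2/M1_of_markerPinned[_of_exchanges]` (`…CrossReachMarkerPinned{,M1,Exchanges,ExchangesM1}.lean`):
* `Consts.crossRel_reach_of_markerSaturated_of_corner` — **THEOREM: if `M₁(1{s↔y}) ≥ 0` and `M₂(1{s↔y}) ≥ 0` then `M₁(F) ≥ 0` and `M₂(F) ≥ 0` for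
  every `F` reading an increasing vertex-cluster event containing `{s↔y}`.**
With `…ConstsCrossReach.lean` (`U ⊆ Z`, `U ⊇ Z`) and `…CrossReachMarkerPinned*` (`U ⊆ Y`) the `u = z` members of `Consts.CrossRel` are thereby
settled on ALL FOUR pinned quadrants of vertex up-events (modulo the exchange files deferred by the farm build of `…SourceLocalFourEvents` and, for
`U ⊇ Z`, (F1) = p367568); the open core at `u = z` is the generic class (events comparable with neither `{s↔y}` nor `{s↔z}`).
Numerics (exact, this seat): the two identities 300/300; `M₁, M₂ ≥ 0` in every instance.
[cite: VandenbergHaggstromKahn2005, Thm. 1.3 (p. 6) with Remark 1 after Thm. 1.2 (p. 5)]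
-/

noncomputable section

namespace Summit.CriticalPhenomena.PercolationContinuityZ3.Theorems

open MeasureTheory Set Literature.Probability.LatticeModels Literature.Probability.Percolation
open scoped Classical

namespace Consts

variable {V : Type*} [Fintype V]

omit [Fintype V] in
/-- `{s ↮ X ∪ {z}} = {s ↮ X} ∖ {s ↔ z}`. [folklore] -/
private theorem avoid_insert_eq_diff₃ (s z : V) (X : Set V) :
    {ω : BondConfig V | ∀ x ∈ insert z X, ¬ (openGraph ω).Reachable s x} =
      {ω : BondConfig V | ∀ x ∈ X, ¬ (openGraph ω).Reachable s x} \ openConn s z := by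
  ext ω; simp only [mem_setOf_eq, forall_mem_insert, mem_sdiff, openConn]; tauto

omit [Fintype V] in
/-- The copy-0 event of the `X ∪ {z}`-slot is disjoint from `{y ↔ z}`. [folklore] -/
private theorem avoidY_insert_inter_conn_eq_empty₃ (s y z : V) (X : Set V) (S : Set (BondConfig V)) :
    {ω : BondConfig V | ∀ x ∈ insert s (insert z X), ¬ (openGraph ω).Reachable y x} ∩ S ∩ openConn y z = ∅ := by
  refine Set.eq_empty_of_forall_notMem fun ω hω => ?_
  exact hω.1.1 z (mem_insert_of_mem s (mem_insert z X)) hω.2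

omit [Fintype V] in
/-- From the corner to the quadrant: if `z̄n·A ≥ B·zn`, `zv·z̄n ≤ zn·z̄v`, `B ≥ 0`, `0 ≤ zv ≤ zn`, `0 ≤ z̄v ≤ z̄n` then `z̄v·A ≥ B·zv`. [folklore] -/
theorem markerSaturated_transfer (A B zv zbv zn zbn : ℝ) (hB : 0 ≤ B) (hzv : 0 ≤ zv) (hzbv : 0 ≤ zbv) (hzvn : zv ≤ zn)
    (hzbvn : zbv ≤ zbn) (hcorner : B * zn ≤ zbn * A) (hcpa : zv * zbn ≤ zn * zbv) : B * zv ≤ zbv * A := by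
  rcases lt_or_ge 0 zbn with hpos | hle
  · -- multiply the target by `zbn > 0`
    have h1 : zbn * (B * zv) ≤ zbn * (zbv * A) := by nlinarith [mul_le_mul_of_nonneg_left hcpa hB, mul_le_mul_of_nonneg_left hcorner hzbv]
    exact le_of_mul_le_mul_left h1 hpos
  · have hzbn0 : zbn = 0 := le_antisymm hle (le_trans hzbv hzbvn)
    have hzbv0 : zbv = 0 := le_antisymm (hzbn0 ▸ hzbvn) hzbv
    have hBzn : B * zn = 0 := le_antisymm (by simpa [hzbn0] using hcorner) (mul_nonneg hB (le_trans hzv hzvn))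
    have hBzv : B * zv ≤ 0 := by nlinarith [mul_le_mul_of_nonneg_left hzvn hB]
    rw [hzbv0, zero_mul]; exact hBzv

set_option maxHeartbeats 400000 in
/-- **CROSS at `u = z` on the marker-saturated quadrant from the corner.**  See the module docstring.
[cite: VandenbergHaggstromKahn2005, Thm. 1.3 (p. 6) with Remark 1 after Thm. 1.2 (p. 5)] -/
theorem crossRel_reach_of_markerSaturated_of_corner (w : Sym2 V → unitInterval) (s y z : V) (X : Set V)
    {𝒰 : Set V → Prop} (h𝒰 : Monotone 𝒰) (hy𝒰 : ∀ S : Set V, y ∈ S → 𝒰 S)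
    (F : Set (Sym2 V) → ℝ) (hF : ∀ ω : BondConfig V, F (openEdgeCluster ω s) = if 𝒰 {v | (openGraph ω).Reachable s v} then 1 else 0)
    (hY1 : 0 ≤ polMargin (prodBernoulli w) s y z (connIndicatorFn s y) (insert z X) X X +
          polMargin (prodBernoulli w) s y z (connIndicatorFn s y) X (insert z X) X +
        polMargin (prodBernoulli w) s y z (connIndicatorFn s y) X X (insert z X))
    (hY2 : 0 ≤ polMargin (prodBernoulli w) s y z (connIndicatorFn s y) (insert z X) (insert z X) X +
          polMargin (prodBernoulli w) s y z (connIndicatorFn s y) (insert z X) X (insert z X) +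
        polMargin (prodBernoulli w) s y z (connIndicatorFn s y) X (insert z X) (insert z X)) :
    (0 ≤ polMargin (prodBernoulli w) s y z F (insert z X) X X + polMargin (prodBernoulli w) s y z F X (insert z X) X +
        polMargin (prodBernoulli w) s y z F X X (insert z X)) ∧
      0 ≤ polMargin (prodBernoulli w) s y z F (insert z X) (insert z X) X +
          polMargin (prodBernoulli w) s y z F (insert z X) X (insert z X) +
        polMargin (prodBernoulli w) s y z F X (insert z X) (insert z X) := by
  classical
  set μ := prodBernoulli w with hμ
  -- degenerate case `z = s`
  by_cases hzs : z = s
  · subst hzs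
    have h0 : ∀ (G : Set (Sym2 V) → ℝ) (X₁ X₂ : Set V), polMargin μ z y z G (insert z X) X₁ X₂ = 0 := fun G X₁ X₂ =>
      polMargin_eq_zero_of_slot0 μ z y z G _ X₁ X₂ (Or.inl (mem_insert z X))
    have h1 : ∀ (G : Set (Sym2 V) → ℝ) (X₀ X₂ : Set V), polMargin μ z y z G X₀ (insert z X) X₂ = 0 := fun G X₀ X₂ =>
      polMargin_eq_zero_of_slot1 μ z y z G X₀ _ X₂ (mem_insert z X)
    have h2 : ∀ (G : Set (Sym2 V) → ℝ) (X₀ X₁ : Set V), polMargin μ z y z G X₀ X₁ (insert z X) = 0 := fun G X₀ X₁ =>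
      polMargin_eq_zero_of_slot2 μ z y z G X₀ X₁ _ (mem_insert z X)
    refine ⟨?_, ?_⟩
    · rw [h0, h1, h2]; norm_num
    · rw [h0, h0, h2]; norm_num
  have hmeas : ∀ S : Set (BondConfig V), MeasurableSet S := fun _ => MeasurableSet.of_discrete
  set D : Set (BondConfig V) := {ω | ∀ x ∈ X, ¬ (openGraph ω).Reachable s x} with hD
  set D' : Set (BondConfig V) := {ω | ∀ x ∈ insert z X, ¬ (openGraph ω).Reachable s x} with hD'
  set A : Set (BondConfig V) := {ω | ∀ x ∈ insert s X, ¬ (openGraph ω).Reachable y x} with hA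
  set A' : Set (BondConfig V) := {ω | ∀ x ∈ insert s (insert z X), ¬ (openGraph ω).Reachable y x} with hA'
  set Yv : Set (BondConfig V) := openConn s y with hYv
  set Zv : Set (BondConfig V) := openConn s z with hZv
  set Wv : Set (BondConfig V) := openConn y z with hWv
  set U : Set (BondConfig V) := {ω | 𝒰 {v | (openGraph ω).Reachable s v}} with hU
  set E : Set (BondConfig V) := {ω | ∀ a ∈ ({s} : Set V), ∀ t ∈ insert y X, ¬ (openGraph ω).Reachable a t} with hE
  have mD' : ∀ ω, ω ∈ D' ↔ ¬ (openGraph ω).Reachable s z ∧ ∀ x ∈ X, ¬ (openGraph ω).Reachable s x := fun ω => by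
    simp only [hD', mem_setOf_eq, forall_mem_insert]
  have mE : ∀ ω, ω ∈ E ↔ ¬ (openGraph ω).Reachable s y ∧ ∀ x ∈ X, ¬ (openGraph ω).Reachable s x := fun ω => by
    simp only [hE, mem_setOf_eq, mem_singleton_iff, forall_eq, forall_mem_insert]
  have mD : ∀ ω, ω ∈ D ↔ ∀ x ∈ X, ¬ (openGraph ω).Reachable s x := fun ω => Iff.rfl
  have mY : ∀ ω, ω ∈ Yv ↔ (openGraph ω).Reachable s y := fun ω => Iff.rfl
  have mZ : ∀ ω, ω ∈ Zv ↔ (openGraph ω).Reachable s z := fun ω => Iff.rfl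
  have mU : ∀ ω, ω ∈ U ↔ 𝒰 {v | (openGraph ω).Reachable s v} := fun ω => Iff.rfl
  -- `Y ⊆ U`
  have hYU : ∀ ω, (openGraph ω).Reachable s y → ω ∈ U := fun ω h => hy𝒰 _ h
  -- the two functionals on clusters
  have hFU : ∀ ω : BondConfig V, F (openEdgeCluster ω s) = U.indicator 1 ω := by
    intro ω
    rw [hF ω]
    by_cases h : 𝒰 {v | (openGraph ω).Reachable s v}
    · rw [if_pos h, indicator_of_mem (show ω ∈ U from h), Pi.one_apply]
    · rw [if_neg h, indicator_of_notMem (show ω ∉ U from h)]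
  have hI : ∀ S : Set (BondConfig V), ∫ ω in S, F (openEdgeCluster ω s) ∂μ = μ.real (S ∩ U) := by
    intro S; simp_rw [hFU]; exact TripodExchange.setIntegral_indicator_one_eq w S U
  have hIY : ∀ S : Set (BondConfig V), ∫ ω in S, connIndicatorFn s y (openEdgeCluster ω s) ∂μ = μ.real (S ∩ Yv) := by
    intro S; simp_rw [connIndicatorFn_openEdgeCluster]; exact TripodExchange.setIntegral_indicator_one_eq w S Yv
  -- set identities
  have sD' : D' = D \ Zv := avoid_insert_eq_diff₃ s z X
  have sD'Z : D' ∩ Zv = ∅ := by rw [sD']; exact Set.sdiff_inter_self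
  have sD'ZU : D' ∩ Zv ∩ U = ∅ := by rw [sD'Z, Set.empty_inter]
  have sD'ZY : D' ∩ Zv ∩ Yv = ∅ := by rw [sD'Z, Set.empty_inter]
  have sA'W : A' ∩ D' ∩ Wv = ∅ := avoidY_insert_inter_conn_eq_empty₃ s y z X D'
  have sDYU : D ∩ Yv ∩ U = D ∩ Yv := by
    ext ω; simp only [mem_inter_iff, mY]
    constructor
    · rintro ⟨h, -⟩; exact h
    · rintro ⟨hd, hy⟩; exact ⟨⟨hd, hy⟩, hYU ω hy⟩
  have sD'YU : D' ∩ Yv ∩ U = D' ∩ Yv := by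
    ext ω; simp only [mem_inter_iff, mY]
    constructor
    · rintro ⟨h, -⟩; exact h
    · rintro ⟨hd, hy⟩; exact ⟨⟨hd, hy⟩, hYU ω hy⟩
  have sYY : ∀ S : Set (BondConfig V), S ∩ Yv ∩ Yv = S ∩ Yv := fun S => by rw [inter_assoc, inter_self]
  have sDZu : (D ∩ Zv) \ U = (D \ U) ∩ Zv := by ext ω; simp only [mem_inter_iff, mem_sdiff]; tauto
  have sDzu : (D \ Zv) \ U = (D \ U) \ Zv := by ext ω; simp only [mem_sdiff]; tauto
  have sDZn : (D ∩ Zv) \ Yv = (D \ Yv) ∩ Zv := by ext ω; simp only [mem_inter_iff, mem_sdiff]; tauto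
  have sDzn : (D \ Zv) \ Yv = (D \ Yv) \ Zv := by ext ω; simp only [mem_sdiff]; tauto
  have sDN : D \ Yv = E := by ext ω; simp only [mem_sdiff, mD, mE, mY]; tauto
  have sEV : E \ U = D \ U := by
    ext ω; simp only [mem_sdiff, mE, mD]
    constructor
    · rintro ⟨⟨-, hd⟩, hu⟩; exact ⟨hd, hu⟩
    · rintro ⟨hd, hu⟩; exact ⟨⟨fun h => hu (hYU ω h), hd⟩, hu⟩
  -- atoms
  set d := μ.real D with hd
  set dz := μ.real (D ∩ Zv) with hdz
  set t := μ.real (A ∩ D) with ht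
  set tw := μ.real (A ∩ D ∩ Wv) with htw
  set tp := μ.real (A' ∩ D') with htp
  set zv := μ.real ((D \ U) ∩ Zv) with hzv
  set zbv := μ.real ((D \ U) \ Zv) with hzbv
  set zn := μ.real ((D \ Yv) ∩ Zv) with hzn
  set zbn := μ.real ((D \ Yv) \ Zv) with hzbn
  have h0 : ∀ S : Set (BondConfig V), 0 ≤ μ.real S := fun _ => measureReal_nonneg
  -- splits
  have r1 : μ.real (D \ U) = zv + zbv := by
    have h := measureReal_inter_add_sdiff (μ := μ) (s := D \ U) (hmeas Zv); linarith
  have r2 : μ.real (D ∩ U) = d - (zv + zbv) := by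
    have h := measureReal_inter_add_sdiff (μ := μ) (s := D) (hmeas U); rw [r1] at h; linarith
  have r3 : μ.real (D ∩ Zv ∩ U) = dz - zv := by
    have h := measureReal_inter_add_sdiff (μ := μ) (s := D ∩ Zv) (hmeas U); rw [sDZu] at h; linarith
  have r4 : μ.real D' = d - dz := by
    have h := measureReal_inter_add_sdiff (μ := μ) (s := D) (hmeas Zv); rw [← sD'] at h; linarith
  have r5 : μ.real (D' ∩ U) = (d - dz) - zbv := by
    have h := measureReal_inter_add_sdiff (μ := μ) (s := D') (hmeas U); rw [sD', sDzu, ← sD', r4] at h; linarith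
  have r6 : μ.real (D \ Yv) = zn + zbn := by
    have h := measureReal_inter_add_sdiff (μ := μ) (s := D \ Yv) (hmeas Zv); linarith
  have r7 : μ.real (D ∩ Yv) = d - (zn + zbn) := by
    have h := measureReal_inter_add_sdiff (μ := μ) (s := D) (hmeas Yv); rw [r6] at h; linarith
  have r8 : μ.real (D ∩ Zv ∩ Yv) = dz - zn := by
    have h := measureReal_inter_add_sdiff (μ := μ) (s := D ∩ Zv) (hmeas Yv); rw [sDZn] at h; linarith
  have r9 : μ.real (D' ∩ Yv) = (d - dz) - zbn := by
    have h := measureReal_inter_add_sdiff (μ := μ) (s := D') (hmeas Yv); rw [sD', sDzn, ← sD', r4] at h; linarith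
  have r10 : μ.real (D' ∩ Zv ∩ U) = 0 := by rw [sD'ZU, measureReal_empty]
  have r11 : μ.real (D' ∩ Zv ∩ Yv) = 0 := by rw [sD'ZY, measureReal_empty]
  have r12 : μ.real (D' ∩ Zv) = 0 := by rw [sD'Z, measureReal_empty]
  have r13 : μ.real (A' ∩ D' ∩ Wv) = 0 := by rw [sA'W, measureReal_empty]
  have hzvn : zv ≤ zn := measureReal_mono (fun ω hω => by
    simp only [mem_inter_iff, mem_sdiff, mY] at hω ⊢; exact ⟨⟨hω.1.1, fun h => hω.1.2 (hYU ω h)⟩, hω.2⟩)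
  have hzbvn : zbv ≤ zbn := measureReal_mono (fun ω hω => by
    simp only [mem_sdiff, mY] at hω ⊢; exact ⟨⟨hω.1.1, fun h => hω.1.2 (hYU ω h)⟩, hω.2⟩)
  -- CPA given `s ↮ X ∪ {y}`: `μ(E)·μ(E ∩ Z ∩ U) ≥ μ(E ∩ Z)·μ(E ∩ U)`
  set G₁ : Set (Sym2 V) → ℝ := fun C => if 𝒰 {v | v = s ∨ ∃ e ∈ C, v ∈ e} then 1 else 0 with hG₁
  have hG₁m : Monotone G₁ := by
    refine TripodExchange.predIndicator_monotone ?_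
    intro C C' hCC' hC
    exact h𝒰 (fun v hv => hv.imp id fun ⟨e, he, hve⟩ => ⟨e, hCC' he, hve⟩) hC
  have hF₁ω : ∀ ω : BondConfig V, connIndicatorFn s z (⋃ a ∈ ({s} : Set V), openEdgeCluster ω a) = Zv.indicator 1 ω := by
    intro ω
    have : (⋃ a ∈ ({s} : Set V), openEdgeCluster ω a) = openEdgeCluster ω s := by ext e; simp
    rw [this, connIndicatorFn_openEdgeCluster]
  have hG₁ω : ∀ ω : BondConfig V, G₁ (⋃ a ∈ ({s} : Set V), openEdgeCluster ω a) = U.indicator 1 ω := by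
    intro ω
    have hC : (⋃ a ∈ ({s} : Set V), openEdgeCluster ω a) = openEdgeCluster ω s := by ext e; simp
    have hset : {v | v = s ∨ ∃ e ∈ openEdgeCluster ω s, v ∈ e} = {v | (openGraph ω).Reachable s v} := by
      ext v; simp only [mem_setOf_eq]; exact (reachable_iff_exists_mem_openEdgeCluster ω s v).symm
    rw [hC]
    simp only [hG₁, hset]
    by_cases h : 𝒰 {v | (openGraph ω).Reachable s v}
    · rw [if_pos h, indicator_of_mem (show ω ∈ U from h), Pi.one_apply]
    · rw [if_neg h, indicator_of_notMem (show ω ∉ U from h)]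
  have hcpa := BHK2006_setClusterConditionalPositiveAssociation w ({s} : Set V) (insert y X) (connIndicatorFn s z) G₁
    (monotone_connIndicatorFn s z) hG₁m
  simp only [hF₁ω, hG₁ω] at hcpa
  change (∫ ω in E, Zv.indicator 1 ω ∂μ) * (∫ ω in E, U.indicator 1 ω ∂μ) ≤
    μ.real E * ∫ ω in E, Zv.indicator 1 ω * U.indicator 1 ω ∂μ at hcpa
  rw [TripodExchange.setIntegral_indicator_one_eq, TripodExchange.setIntegral_indicator_one_eq,
    TripodExchange.setIntegral_indicator_mul_indicator_eq] at hcpa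
  -- `E = D ∖ Y`; express in atoms: μ(E) = zn+zbn, μ(E∩Zv) = zn, μ(E∩U) = μ(E) − μ(E∖U), μ(E∩(Zv∩U)) = zn − zv
  have rE : μ.real E = zn + zbn := by rw [← sDN, r6]
  have rEZ : μ.real (E ∩ Zv) = zn := by rw [← sDN, hzn]
  have rEU : μ.real (E ∩ U) = (zn + zbn) - (zv + zbv) := by
    have h := measureReal_inter_add_sdiff (μ := μ) (s := E) (hmeas U); rw [sEV, r1, rE] at h; linarith
  have rEZU : μ.real (E ∩ (Zv ∩ U)) = zn - zv := by
    have h := measureReal_inter_add_sdiff (μ := μ) (s := E ∩ Zv) (hmeas U)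
    have h2 : (E ∩ Zv) \ U = (D \ U) ∩ Zv := by
      rw [← sDN]; ext ω; simp only [mem_inter_iff, mem_sdiff, mY]
      constructor
      · rintro ⟨⟨⟨hd, -⟩, hz⟩, hu⟩; exact ⟨⟨hd, hu⟩, hz⟩
      · rintro ⟨⟨hd, hu⟩, hz⟩; exact ⟨⟨⟨hd, fun h => hu (hYU ω h)⟩, hz⟩, hu⟩
    rw [h2, rEZ, ← hzv] at h
    rw [← inter_assoc]; linarith
  rw [rE, rEZ, rEU, rEZU] at hcpa
  have hcpa' : zv * zbn ≤ zn * zbv := by nlinarith [hcpa]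
  -- the hypotheses and the goal in atoms
  unfold polMargin at hY1 hY2 ⊢
  rw [hIY, hIY, hIY, hIY, hIY, hIY, sYY, sYY, r13, r12, r11, r8, r7, r9, r4] at hY1 hY2
  rw [hI, hI, hI, hI, hI, hI, sDYU, sD'YU, r13, r12, r10, r3, r2, r5, r7, r9, r4]
  have htp0 : 0 ≤ tp := h0 _
  have htw0 : 0 ≤ tw := h0 _
  have ht0 : 0 ≤ t := h0 _
  have hd'0 : 0 ≤ d - dz := by rw [← r4]; exact h0 _
  have hdy'0 : 0 ≤ d - dz - zbn := by rw [← r9]; exact h0 _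
  refine ⟨?_, ?_⟩
  · -- M₁ = z̄v·α − zv·β, α = (t+t')dz − tw(dy + dy'), β = (t+t')d' + tw dy'
    have e : ∀ a b : ℝ, tp * (d * (dz - a) - (d - (a + b)) * dz) - 0 * (d * (d - (zn + zbn)) - (d - (a + b)) * (d - (zn + zbn))) +
        (t * ((d - dz) * (dz - a) - ((d - dz) - b) * dz) - tw * ((d - dz) * (d - (zn + zbn)) - ((d - dz) - b) * (d - (zn + zbn)))) +
        (t * (d * 0 - (d - (a + b)) * 0) - tw * (d * ((d - dz) - zbn) - (d - (a + b)) * ((d - dz) - zbn))) =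
        b * ((t + tp) * dz - tw * ((d - (zn + zbn)) + ((d - dz) - zbn))) - ((t + tp) * (d - dz) + tw * ((d - dz) - zbn)) * a := by
      intro a b; ring
    rw [e zn zbn] at hY1; rw [e zv zbv]
    have hB : 0 ≤ (t + tp) * (d - dz) + tw * ((d - dz) - zbn) := by positivity
    have hc : ((t + tp) * (d - dz) + tw * ((d - dz) - zbn)) * zn ≤
        zbn * ((t + tp) * dz - tw * ((d - (zn + zbn)) + ((d - dz) - zbn))) := by linarith [hY1]
    linarith [markerSaturated_transfer ((t + tp) * dz - tw * ((d - (zn + zbn)) + ((d - dz) - zbn)))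
      ((t + tp) * (d - dz) + tw * ((d - dz) - zbn)) zv zbv zn zbn hB (h0 _) (h0 _) hzvn hzbvn hc hcpa']
  · -- M₂ = z̄v·(t'dz − tw dy') − t'd'·zv
    have e : ∀ a b : ℝ, tp * ((d - dz) * (dz - a) - ((d - dz) - b) * dz) - 0 * ((d - dz) * (d - (zn + zbn)) - ((d - dz) - b) * (d - (zn + zbn))) +
        (tp * (d * 0 - (d - (a + b)) * 0) - 0 * (d * ((d - dz) - zbn) - (d - (a + b)) * ((d - dz) - zbn))) +
        (t * ((d - dz) * 0 - ((d - dz) - b) * 0) - tw * ((d - dz) * ((d - dz) - zbn) - ((d - dz) - b) * ((d - dz) - zbn))) =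
        b * (tp * dz - tw * ((d - dz) - zbn)) - (tp * (d - dz)) * a := by
      intro a b; ring
    rw [e zn zbn] at hY2; rw [e zv zbv]
    have hB : 0 ≤ tp * (d - dz) := mul_nonneg htp0 hd'0
    have hc : (tp * (d - dz)) * zn ≤ zbn * (tp * dz - tw * ((d - dz) - zbn)) := by linarith [hY2]
    linarith [markerSaturated_transfer (tp * dz - tw * ((d - dz) - zbn)) (tp * (d - dz)) zv zbv zn zbn hB (h0 _) (h0 _) hzvn hzbvn hc hcpa']

end Consts

end Summit.CriticalPhenomena.PercolationContinuityZ3.Theorems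

end
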